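import Mathlib.Data.Real.Basic
import Mathlib.Tactic.Linarith
import Mathlib.Tactic.Ring
import Mathlib.Tactic.Positivity
import HarnessLib

/-!
# Sharp KN Conjecture 1 on cacti with cycles of length ≤ 4 — the algebraic core of LEMMA K3 (the 4-cycle petal), machine-checked
# (`NoHeavyLowerTail` cell, stmt-CriticalPhenomena-4575; new-inequality factory seat `prim-ineq-gen-7`, gen 5; support file)

Paper proof: run/shared/lean/prim/prim-ineq-gen-7/PROOF-K3.md (§2, §6).  A cycle `o, u₁, u₂, u₃` through the observer `o` carries opaque blocks
`B_i = (a_i, b_i)` (`0 ≤ b_i ≤ a_i ≤ 1`: P(root cluster hub-free) ≥ P(hub-free and relay-free)) at `u_i`; write `s_i := 1 − b_i`, `μ_i := (a_i − b_i)/s_i`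
(conditional hub-avoidance), so `a_i = b_i + s_i μ_i` and `1 − a_i = s_i(1 − μ_i)`.  For an ordered pair (root `r`, child `c`) joined by an edge of weight `e` the
two-block structure observed from the root has conditional hub-avoidance `μ(r ⊛ₑ c) = N_r / D_r` with
`N_r = μ_r s_r (1 − e s_c (1 − μ_c)) + b_r e μ_c s_c`, `D_r = s_r + b_r e s_c`, and the root's extremal relay has value `V_r(e) = μ_r (1 − e s_r s_c (1 − μ_c))` there.
LEMMA K3 (PROOF-K3 §3, §6) selects, for every 3-block path, a block whose certifier certifies the three corners of the petal; its proof rests on the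
exact identities (I1)–(I6) and the comparisons (G1‴), (V), (E12′) below — pure real algebra, no measure theory, no definitions, no sorries:

* `RingK3Algebra.I1` — `N₂D₃ − N₃D₂ = s₂s₃(1−e)[(μ₂−μ₃)(1+e b₃) + e μ₃(1−μ₂)(s₂−s₃)]`;  `RingK3Algebra.I2` — `N₃ − V₃D₃ = b₃ e s₂[(μ₂−μ₃) − μ₃s₃(1−μ₂)(1−e s₂)]`;
* `RingK3Algebra.G1ppp` — **(G1‴)** `μ(3 ⊛ₑ 2) ≤ max(μ(2 ⊛ₑ 3), V₃(e))` in the division-free form `N₃D₂ ≤ N₂D₃ ∨ N₃ ≤ V₃D₃`;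
* `RingK3Algebra.I3` — `N₂ = D₂ − (1 − a₂G)`, `G = 1 − e(1−a₃)` (i.e. `1 − μ(2 ⊛ₑ 3) = (1 − a₂G)/D₂`);
* `RingK3Algebra.Bprime_nonneg` — `(1 − Q s₃ w)D₂ − q₂ s₃ a₂ ≥ 0` (`w = 1 − a₂`, `Q = q₁ + q₂ − q₁q₂`, `D₂ = s₂ + b₂q₂s₃`), the core of **(V)**, and
  `RingK3Algebra.V_core` — `B·D₂ ≥ 0` under the hypothesis `(1−μ₁)D₂ ≤ 1 − a₂G₂₃` (= `μ₁ ≥ μ(2 ⊛_{q₂} 3)` cross-multiplied), where `B` is the bracket of (I4);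
* `RingK3Algebra.I6` and `RingK3Algebra.E12p` — **(E12′)** `π₂ ≥ π₃` from `μ₃ ≤ μ₂G₂₁` (the consequence of `μ_{R′} > μ₃ ≥ μ₁`).
[cite: KozmaNitzan2024, Conjecture 1 (p. 3), Theorem 1 / §3] [this file]
-/

namespace Summit.CriticalPhenomena.PercolationContinuityZ3.Theorems

namespace RingK3Algebra

/-- **(I1)** the Möbius comparison identity for the two orderings of a two-block structure (root 2 / child 3 versus root 3 / child 2, same edge `e`):
`N₂·D₃ − N₃·D₂ = s₂ s₃ (1−e)·[(μ₂−μ₃)(1 + e b₃) + e μ₃ (1−μ₂)(s₂ − s₃)]`, `s_i = 1 − b_i`. [this file] -/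
theorem I1 (b₂ μ₂ b₃ μ₃ e : ℝ) :
    (μ₂ * (1 - b₂) * (1 - e * (1 - b₃) * (1 - μ₃)) + b₂ * e * μ₃ * (1 - b₃)) * ((1 - b₃) + b₃ * e * (1 - b₂))
      - (μ₃ * (1 - b₃) * (1 - e * (1 - b₂) * (1 - μ₂)) + b₃ * e * μ₂ * (1 - b₂)) * ((1 - b₂) + b₂ * e * (1 - b₃))
      = (1 - b₂) * (1 - b₃) * (1 - e) *
        ((μ₂ - μ₃) * (1 + e * b₃) + e * μ₃ * (1 - μ₂) * ((1 - b₂) - (1 - b₃))) := by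
  ring

/-- **(I2)** `N₃ − V₃(e)·D₃ = b₃ e s₂·[(μ₂ − μ₃) − μ₃ s₃ (1−μ₂)(1 − e s₂)]`, with `V₃(e) = μ₃(1 − e s₃ s₂ (1−μ₂))`. [this file] -/
theorem I2 (b₂ μ₂ b₃ μ₃ e : ℝ) :
    (μ₃ * (1 - b₃) * (1 - e * (1 - b₂) * (1 - μ₂)) + b₃ * e * μ₂ * (1 - b₂))
      - μ₃ * (1 - e * (1 - b₃) * ((1 - b₂) * (1 - μ₂))) * ((1 - b₃) + b₃ * e * (1 - b₂))
      = b₃ * e * (1 - b₂) * ((μ₂ - μ₃) - μ₃ * (1 - b₃) * (1 - μ₂) * (1 - e * (1 - b₂))) := by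
  ring

/-- **(G1‴)**, division-free: for blocks `2, 3` (`b, μ ∈ [0,1]`) and an edge weight `e ∈ [0,1]`, either `N₃·D₂ ≤ N₂·D₃` (i.e. `μ(3 ⊛ₑ 2) ≤ μ(2 ⊛ₑ 3)`) or
`N₃ ≤ V₃(e)·D₃` (i.e. `μ(3 ⊛ₑ 2) ≤ V₃(e)`).  Proof: if `N₃ > V₃D₃` then by (I2) `μ₂ − μ₃ ≥ μ₃s₃(1−μ₂)(1−e s₂)`, and (I1) becomes a sum of nonnegative terms.
[this file] -/
theorem G1ppp (b₂ μ₂ b₃ μ₃ e : ℝ) (hb₂ : 0 ≤ b₂) (hb₂1 : b₂ ≤ 1) (hb₃ : 0 ≤ b₃) (hb₃1 : b₃ ≤ 1)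
    (hμ₂1 : μ₂ ≤ 1) (hμ₃ : 0 ≤ μ₃) (he : 0 ≤ e) (he1 : e ≤ 1) :
    (μ₃ * (1 - b₃) * (1 - e * (1 - b₂) * (1 - μ₂)) + b₃ * e * μ₂ * (1 - b₂)) * ((1 - b₂) + b₂ * e * (1 - b₃))
        ≤ (μ₂ * (1 - b₂) * (1 - e * (1 - b₃) * (1 - μ₃)) + b₂ * e * μ₃ * (1 - b₃)) * ((1 - b₃) + b₃ * e * (1 - b₂))
      ∨ (μ₃ * (1 - b₃) * (1 - e * (1 - b₂) * (1 - μ₂)) + b₃ * e * μ₂ * (1 - b₂))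
        ≤ μ₃ * (1 - e * (1 - b₃) * ((1 - b₂) * (1 - μ₂))) * ((1 - b₃) + b₃ * e * (1 - b₂)) := by
  by_cases h : (μ₃ * (1 - b₃) * (1 - e * (1 - b₂) * (1 - μ₂)) + b₃ * e * μ₂ * (1 - b₂))
        ≤ μ₃ * (1 - e * (1 - b₃) * ((1 - b₂) * (1 - μ₂))) * ((1 - b₃) + b₃ * e * (1 - b₂))
  · exact Or.inr h
  · left
    -- the gap `g := (μ₂ − μ₃) − μ₃ s₃ (1−μ₂)(1 − e s₂)` is nonnegative: by (I2), `b₃ e s₂ · g > 0` and `b₃ e s₂ ≥ 0`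
    set g : ℝ := (μ₂ - μ₃) - μ₃ * (1 - b₃) * (1 - μ₂) * (1 - e * (1 - b₂)) with hg
    have hprod : 0 < b₃ * e * (1 - b₂) * g := by
      have := I2 b₂ μ₂ b₃ μ₃ e
      rw [← hg] at this
      linarith [lt_of_not_ge h]
    have hcoef : 0 ≤ b₃ * e * (1 - b₂) := by
      have : 0 ≤ 1 - b₂ := by linarith
      positivity
    have hgpos : 0 ≤ g := by
      by_contra hneg
      have hneg' : g < 0 := lt_of_not_ge hneg
      have : b₃ * e * (1 - b₂) * g ≤ 0 := mul_nonpos_of_nonneg_of_nonpos hcoef hneg'.le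
      linarith
    -- rewrite the (I1) difference as a manifestly nonnegative expression using `g`
    have key : (μ₂ * (1 - b₂) * (1 - e * (1 - b₃) * (1 - μ₃)) + b₂ * e * μ₃ * (1 - b₃)) * ((1 - b₃) + b₃ * e * (1 - b₂))
        - (μ₃ * (1 - b₃) * (1 - e * (1 - b₂) * (1 - μ₂)) + b₃ * e * μ₂ * (1 - b₂)) * ((1 - b₂) + b₂ * e * (1 - b₃))
        = (1 - b₂) * (1 - b₃) * (1 - e) *
          (g * (1 + e * b₃) + μ₃ * (1 - μ₂) * ((1 - b₃) * (1 - e) + e * (1 - b₂) * b₃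
              + e * b₃ * (1 - b₃) * (1 - e * (1 - b₂)))) := by
      rw [hg]; ring
    have h1 : 0 ≤ 1 - b₂ := by linarith
    have h2 : 0 ≤ 1 - b₃ := by linarith
    have h3 : 0 ≤ 1 - e := by linarith
    have h4 : 0 ≤ 1 - μ₂ := by linarith
    have h5 : 0 ≤ 1 - e * (1 - b₂) := by nlinarith
    have hin : 0 ≤ g * (1 + e * b₃) + μ₃ * (1 - μ₂) * ((1 - b₃) * (1 - e) + e * (1 - b₂) * b₃
              + e * b₃ * (1 - b₃) * (1 - e * (1 - b₂))) := by positivity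
    have : 0 ≤ (1 - b₂) * (1 - b₃) * (1 - e) *
          (g * (1 + e * b₃) + μ₃ * (1 - μ₂) * ((1 - b₃) * (1 - e) + e * (1 - b₂) * b₃
              + e * b₃ * (1 - b₃) * (1 - e * (1 - b₂)))) := by positivity
    linarith [key]

/-- **(I3)** `N₂ = D₂ − (1 − a₂ G)` with `a₂ = b₂ + (1−b₂)μ₂`, `a₃ = b₃ + (1−b₃)μ₃`, `G = 1 − e(1 − a₃)`, `D₂ = s₂ + b₂ e s₃`; equivalently
`1 − μ(2 ⊛ₑ 3) = (1 − a₂G)/D₂`. [this file] -/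
theorem I3 (b₂ μ₂ b₃ μ₃ e : ℝ) :
    μ₂ * (1 - b₂) * (1 - e * (1 - b₃) * (1 - μ₃)) + b₂ * e * μ₃ * (1 - b₃)
      = ((1 - b₂) + b₂ * e * (1 - b₃)) - (1 - (b₂ + (1 - b₂) * μ₂) * (1 - e * (1 - (b₃ + (1 - b₃) * μ₃)))) := by
  ring

/-- **(I5) and `B′D₂ ≥ 0`** (core of (V)): with `w = 1 − a₂ = (1−b₂)(1−μ₂)`, `a₂ = 1 − w`, `Q = q₁ + q₂ − q₁q₂`, `D₂ = s₂ + b₂ q₂ s₃`: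
`(1 − Q s₃ w)·D₂ − q₂ s₃ a₂ ≥ 0` on the box. Identity used: it equals `(1 − q₂s₃)(s₂ + b₂q₂s₃w) − q₁(1−q₂)s₃ w D₂`. [this file] -/
theorem Bprime_nonneg (b₂ μ₂ b₃ q₁ q₂ : ℝ) (hb₂ : 0 ≤ b₂) (hb₂1 : b₂ ≤ 1) (hb₃ : 0 ≤ b₃) (hb₃1 : b₃ ≤ 1)
    (hμ₂ : 0 ≤ μ₂) (hμ₂1 : μ₂ ≤ 1) (hq₁ : 0 ≤ q₁) (hq₁1 : q₁ ≤ 1) (hq₂ : 0 ≤ q₂) (hq₂1 : q₂ ≤ 1) :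
    0 ≤ (1 - (q₁ + q₂ - q₁ * q₂) * (1 - b₃) * ((1 - b₂) * (1 - μ₂))) * ((1 - b₂) + b₂ * q₂ * (1 - b₃))
        - q₂ * (1 - b₃) * (1 - (1 - b₂) * (1 - μ₂)) := by
  -- exact identity: the quantity equals
  --   (1−q₂)·[ s₂(1 − q₁s₃w) + b₂q₂s₃w(1 − q₁s₃) ] + q₂b₃·(s₂ + b₂q₂s₃w),   w = (1−b₂)(1−μ₂), s_i = 1 − b_i
  have key : (1 - (q₁ + q₂ - q₁ * q₂) * (1 - b₃) * ((1 - b₂) * (1 - μ₂))) * ((1 - b₂) + b₂ * q₂ * (1 - b₃))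
        - q₂ * (1 - b₃) * (1 - (1 - b₂) * (1 - μ₂))
      = (1 - q₂) * ((1 - b₂) * (1 - q₁ * (1 - b₃) * ((1 - b₂) * (1 - μ₂)))
          + b₂ * q₂ * (1 - b₃) * ((1 - b₂) * (1 - μ₂)) * (1 - q₁ * (1 - b₃)))
        + q₂ * b₃ * ((1 - b₂) + b₂ * q₂ * (1 - b₃) * ((1 - b₂) * (1 - μ₂))) := by ring
  have h1 : 0 ≤ 1 - b₂ := by linarith
  have h2 : 0 ≤ 1 - b₃ := by linarith
  have h3 : 0 ≤ 1 - μ₂ := by linarith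
  have h4 : 0 ≤ 1 - q₂ := by linarith
  have hw1 : (1 - b₃) * ((1 - b₂) * (1 - μ₂)) ≤ 1 := by
    have hx : (1 - b₂) * (1 - μ₂) ≤ 1 := by nlinarith
    nlinarith [mul_nonneg h1 h3]
  have h5 : 0 ≤ 1 - q₁ * (1 - b₃) * ((1 - b₂) * (1 - μ₂)) := by
    have : q₁ * ((1 - b₃) * ((1 - b₂) * (1 - μ₂))) ≤ 1 * 1 :=
      mul_le_mul hq₁1 hw1 (by positivity) zero_le_one
    nlinarith
  have h6 : 0 ≤ 1 - q₁ * (1 - b₃) := by nlinarith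
  rw [key]
  positivity

/-- **(I4)** `π₃ − φ₁·V₃(Q) = μ₃ q₁·[(1−q₂) s₃ (1−a₂) + s₁·B]` with `φ₁ = 1 − s₁q₁(1 − a₂G₂₃)`, `V₃(Q) = μ₃(1 − Q s₃ (1−a₂))`,
`π₃ = μ₃(1 − s₃ q₂ (1 − a₂ G₂₁))`, `G₂₁ = 1 − q₁ s₁ (1−μ₁)`, `G₂₃ = 1 − q₂ s₃ (1−μ₃)`, `Q = q₁ + q₂ − q₁q₂`, and
`B = (1 − a₂G₂₃)(1 − Q s₃ (1−a₂)) − q₂ s₃ a₂ (1−μ₁)`; here `a₂ = b₂ + s₂μ₂`. [this file] -/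
theorem I4 (b₁ μ₁ b₂ μ₂ b₃ μ₃ q₁ q₂ : ℝ) :
    μ₃ * (1 - (1 - b₃) * q₂ * (1 - (b₂ + (1 - b₂) * μ₂) * (1 - q₁ * (1 - b₁) * (1 - μ₁))))
      - (1 - (1 - b₁) * q₁ * (1 - (b₂ + (1 - b₂) * μ₂) * (1 - q₂ * (1 - b₃) * (1 - μ₃))))
        * (μ₃ * (1 - (q₁ + q₂ - q₁ * q₂) * (1 - b₃) * ((1 - b₂) * (1 - μ₂))))
      = μ₃ * q₁ * ((1 - q₂) * (1 - b₃) * ((1 - b₂) * (1 - μ₂))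
          + (1 - b₁) * ((1 - (b₂ + (1 - b₂) * μ₂) * (1 - q₂ * (1 - b₃) * (1 - μ₃)))
                * (1 - (q₁ + q₂ - q₁ * q₂) * (1 - b₃) * ((1 - b₂) * (1 - μ₂)))
              - q₂ * (1 - b₃) * (b₂ + (1 - b₂) * μ₂) * (1 - μ₁))) := by
  ring

/-- **(V), division-free core.**  If `μ₁ ≥ μ(2 ⊛_{q₂} 3)`, written cross-multiplied as `(1 − μ₁)·D₂ ≤ 1 − a₂G₂₃` (`D₂ = s₂ + b₂q₂s₃ ≥ 0`, see (I3)),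
then `D₂·(π₃ − φ₁ V₃(Q)) ≥ 0` (notation of (I4)); so `φ₁V₃(Q) ≤ π₃` whenever `D₂ > 0` (and trivially in the degenerate case `D₂ = 0`).
Proof: (I4), `B·D₂ ≥ (1 − a₂G₂₃)·[(1 − Qs₃w)D₂ − q₂s₃a₂] ≥ 0` by the hypothesis and `Bprime_nonneg`. [this file] -/
theorem V_core (b₁ μ₁ b₂ μ₂ b₃ μ₃ q₁ q₂ : ℝ) (hb₁1 : b₁ ≤ 1) (hb₂ : 0 ≤ b₂) (hb₂1 : b₂ ≤ 1)
    (hb₃ : 0 ≤ b₃) (hb₃1 : b₃ ≤ 1) (hμ₂ : 0 ≤ μ₂) (hμ₂1 : μ₂ ≤ 1) (hμ₃ : 0 ≤ μ₃) (hμ₃1 : μ₃ ≤ 1)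
    (hq₁ : 0 ≤ q₁) (hq₁1 : q₁ ≤ 1) (hq₂ : 0 ≤ q₂) (hq₂1 : q₂ ≤ 1)
    (hL : (1 - μ₁) * ((1 - b₂) + b₂ * q₂ * (1 - b₃))
      ≤ 1 - (b₂ + (1 - b₂) * μ₂) * (1 - q₂ * (1 - b₃) * (1 - μ₃))) :
    0 ≤ ((1 - b₂) + b₂ * q₂ * (1 - b₃)) *
      (μ₃ * (1 - (1 - b₃) * q₂ * (1 - (b₂ + (1 - b₂) * μ₂) * (1 - q₁ * (1 - b₁) * (1 - μ₁))))
        - (1 - (1 - b₁) * q₁ * (1 - (b₂ + (1 - b₂) * μ₂) * (1 - q₂ * (1 - b₃) * (1 - μ₃))))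
          * (μ₃ * (1 - (q₁ + q₂ - q₁ * q₂) * (1 - b₃) * ((1 - b₂) * (1 - μ₂))))) := by
  rw [I4]
  set A : ℝ := 1 - (b₂ + (1 - b₂) * μ₂) * (1 - q₂ * (1 - b₃) * (1 - μ₃)) with hA
  set W : ℝ := 1 - (q₁ + q₂ - q₁ * q₂) * (1 - b₃) * ((1 - b₂) * (1 - μ₂)) with hW
  set D : ℝ := (1 - b₂) + b₂ * q₂ * (1 - b₃) with hD
  set c : ℝ := q₂ * (1 - b₃) * (b₂ + (1 - b₂) * μ₂) with hc
  have h1 : 0 ≤ 1 - b₁ := by linarith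
  have h2 : 0 ≤ 1 - b₂ := by linarith
  have h3 : 0 ≤ 1 - b₃ := by linarith
  have h4 : 0 ≤ 1 - μ₂ := by linarith
  have h5 : 0 ≤ 1 - q₂ := by linarith
  have hD0 : 0 ≤ D := by rw [hD]; positivity
  have hc0 : 0 ≤ c := by rw [hc]; positivity
  have ha₂1 : b₂ + (1 - b₂) * μ₂ ≤ 1 := by nlinarith
  have hG0 : 0 ≤ 1 - q₂ * (1 - b₃) * (1 - μ₃) := by
    have : q₂ * ((1 - b₃) * (1 - μ₃)) ≤ 1 * 1 := mul_le_mul hq₂1 (by nlinarith) (by positivity) zero_le_one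
    nlinarith
  have hG1 : 1 - q₂ * (1 - b₃) * (1 - μ₃) ≤ 1 := by
    have : 0 ≤ 1 - μ₃ := by linarith
    have : 0 ≤ q₂ * (1 - b₃) * (1 - μ₃) := by positivity
    linarith
  have hA0 : 0 ≤ A := by
    have : (b₂ + (1 - b₂) * μ₂) * (1 - q₂ * (1 - b₃) * (1 - μ₃)) ≤ 1 * 1 :=
      mul_le_mul ha₂1 hG1 hG0 zero_le_one
    rw [hA]; linarith
  -- B′·D ≥ 0, in the variables of this theorem
  have hBp : 0 ≤ W * D - c := by
    have h := Bprime_nonneg b₂ μ₂ b₃ q₁ q₂ hb₂ hb₂1 hb₃ hb₃1 hμ₂ hμ₂1 hq₁ hq₁1 hq₂ hq₂1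
    have e : (1 - (q₁ + q₂ - q₁ * q₂) * (1 - b₃) * ((1 - b₂) * (1 - μ₂))) * ((1 - b₂) + b₂ * q₂ * (1 - b₃))
        - q₂ * (1 - b₃) * (1 - (1 - b₂) * (1 - μ₂)) = W * D - c := by
      rw [hW, hD, hc]; ring
    rw [e] at h; exact h
  -- B·D = A·(W·D − c) + c·(A − (1−μ₁)·D) ≥ 0
  have hBD : 0 ≤ (A * W - c * (1 - μ₁)) * D := by
    have e : (A * W - c * (1 - μ₁)) * D = A * (W * D - c) + c * (A - (1 - μ₁) * D) := by ring
    rw [e]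
    have t1 : 0 ≤ A * (W * D - c) := mul_nonneg hA0 hBp
    have t2 : 0 ≤ c * (A - (1 - μ₁) * D) := mul_nonneg hc0 (by rw [hD, hA]; linarith)
    linarith
  have e2 : D * (μ₃ * q₁ * ((1 - q₂) * (1 - b₃) * ((1 - b₂) * (1 - μ₂)) + (1 - b₁) * (A * W - c * (1 - μ₁))))
      = μ₃ * q₁ * ((1 - q₂) * (1 - b₃) * ((1 - b₂) * (1 - μ₂)) * D + (1 - b₁) * ((A * W - c * (1 - μ₁)) * D)) := by
    ring
  rw [e2]
  have t3 : 0 ≤ (1 - q₂) * (1 - b₃) * ((1 - b₂) * (1 - μ₂)) * D := by positivity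
  have t4 : 0 ≤ (1 - b₁) * ((A * W - c * (1 - μ₁)) * D) := mul_nonneg h1 hBD
  have : 0 ≤ μ₃ * q₁ := by positivity
  exact mul_nonneg this (add_nonneg t3 t4)

/-- **(I6)** `π₂ − π₃ = (μ₂ − μ₃)(1 − s₂ s₃ q₂) − (1 − G₂₁)·[μ₂ s₂ G₂₃ − μ₃ s₃ q₂ a₂]`, where `π₂ = μ₂(b₂ + s₂ G₂₁ G₂₃)`,
`π₃ = μ₃(1 − s₃ q₂ (1 − a₂ G₂₁))`, `G₂₃ = 1 − q₂ s₃ (1−μ₃)`, `a₂ = b₂ + s₂ μ₂`, and `G₂₁` is a free parameter. [this file] -/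
theorem I6 (b₂ μ₂ b₃ μ₃ q₂ G : ℝ) :
    μ₂ * (b₂ + (1 - b₂) * G * (1 - q₂ * (1 - b₃) * (1 - μ₃)))
        - μ₃ * (1 - (1 - b₃) * q₂ * (1 - (b₂ + (1 - b₂) * μ₂) * G))
      = (μ₂ - μ₃) * (1 - (1 - b₂) * (1 - b₃) * q₂)
        - (1 - G) * (μ₂ * (1 - b₂) * (1 - q₂ * (1 - b₃) * (1 - μ₃)) - μ₃ * (1 - b₃) * q₂ * (b₂ + (1 - b₂) * μ₂)) := by
  ring

/-- **(E12′)**: if `μ₃ ≤ μ₂ G₂₁` (which follows from `μ(2 ⊛_{q₁} 1) > μ₃ ≥ μ₁`) with `G₂₁ ∈ [0,1]`, then `π₂ ≥ π₃` (notation of (I6)).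
Proof: by (I6), `π₂ − π₃ ≥ (1 − G₂₁)·b₂·(μ₂ + μ₃ s₃ q₂) ≥ 0` when the bracket is nonnegative, and `≥ 0` directly otherwise. [this file] -/
theorem E12p (b₂ μ₂ b₃ μ₃ q₂ G : ℝ) (hb₂ : 0 ≤ b₂) (hb₂1 : b₂ ≤ 1) (hb₃ : 0 ≤ b₃) (hb₃1 : b₃ ≤ 1)
    (hμ₂ : 0 ≤ μ₂) (hμ₃ : 0 ≤ μ₃) (hμ₃1 : μ₃ ≤ 1) (hq₂ : 0 ≤ q₂) (hq₂1 : q₂ ≤ 1)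
    (hG1 : G ≤ 1) (hcmp : μ₃ ≤ μ₂ * G) :
    μ₃ * (1 - (1 - b₃) * q₂ * (1 - (b₂ + (1 - b₂) * μ₂) * G))
      ≤ μ₂ * (b₂ + (1 - b₂) * G * (1 - q₂ * (1 - b₃) * (1 - μ₃))) := by
  have hI6 := I6 b₂ μ₂ b₃ μ₃ q₂ G
  have h1 : 0 ≤ 1 - b₂ := by linarith
  have h2 : 0 ≤ 1 - b₃ := by linarith
  have h3 : 0 ≤ 1 - μ₃ := by linarith
  have h4 : 0 ≤ 1 - G := by linarith
  have hc : 0 ≤ 1 - (1 - b₂) * (1 - b₃) * q₂ := by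
    have : (1 - b₂) * (1 - b₃) * q₂ ≤ 1 * 1 * 1 := by
      have := mul_le_mul (mul_le_mul (by linarith : 1 - b₂ ≤ 1) (by linarith : 1 - b₃ ≤ 1) h2 zero_le_one) hq₂1 hq₂ (by positivity)
      linarith
    linarith
  -- μ₂ − μ₃ ≥ μ₂ (1 − G) ≥ 0
  have hgap : μ₂ * (1 - G) ≤ μ₂ - μ₃ := by nlinarith
  have hμ23 : μ₃ ≤ μ₂ := by nlinarith
  -- the identity μ₂(1 − s₂s₃q₂) − μ₂ s₂ G₂₃ + μ₃ s₃ q₂ a₂ = b₂ (μ₂ + μ₃ s₃ q₂)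
  have hid : μ₂ * (1 - (1 - b₂) * (1 - b₃) * q₂) - μ₂ * (1 - b₂) * (1 - q₂ * (1 - b₃) * (1 - μ₃))
      + μ₃ * (1 - b₃) * q₂ * (b₂ + (1 - b₂) * μ₂) = b₂ * (μ₂ + μ₃ * (1 - b₃) * q₂) := by ring
  by_cases hbr : μ₂ * (1 - b₂) * (1 - q₂ * (1 - b₃) * (1 - μ₃)) - μ₃ * (1 - b₃) * q₂ * (b₂ + (1 - b₂) * μ₂) ≤ 0
  · -- bracket ≤ 0: both terms of (I6) are ≥ 0
    have : 0 ≤ (μ₂ - μ₃) * (1 - (1 - b₂) * (1 - b₃) * q₂) := mul_nonneg (by linarith) hc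
    nlinarith [mul_nonneg h4 (by linarith : 0 ≤ -(μ₂ * (1 - b₂) * (1 - q₂ * (1 - b₃) * (1 - μ₃))
      - μ₃ * (1 - b₃) * q₂ * (b₂ + (1 - b₂) * μ₂)))]
  · have hbr' := lt_of_not_ge hbr
    -- bracket > 0: use μ₂ − μ₃ ≥ μ₂(1 − G)
    have step : (1 - G) * (μ₂ * (1 - (1 - b₂) * (1 - b₃) * q₂)
        - (μ₂ * (1 - b₂) * (1 - q₂ * (1 - b₃) * (1 - μ₃)) - μ₃ * (1 - b₃) * q₂ * (b₂ + (1 - b₂) * μ₂)))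
        ≤ (μ₂ - μ₃) * (1 - (1 - b₂) * (1 - b₃) * q₂)
          - (1 - G) * (μ₂ * (1 - b₂) * (1 - q₂ * (1 - b₃) * (1 - μ₃)) - μ₃ * (1 - b₃) * q₂ * (b₂ + (1 - b₂) * μ₂)) := by
      nlinarith [mul_le_mul_of_nonneg_right hgap hc]
    have pos : 0 ≤ (1 - G) * (b₂ * (μ₂ + μ₃ * (1 - b₃) * q₂)) := by positivity
    have : (1 - G) * (μ₂ * (1 - (1 - b₂) * (1 - b₃) * q₂)
        - (μ₂ * (1 - b₂) * (1 - q₂ * (1 - b₃) * (1 - μ₃)) - μ₃ * (1 - b₃) * q₂ * (b₂ + (1 - b₂) * μ₂)))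
        = (1 - G) * (b₂ * (μ₂ + μ₃ * (1 - b₃) * q₂)) := by rw [← hid]; ring
    linarith

end RingK3Algebra

end Summit.CriticalPhenomena.PercolationContinuityZ3.Theorems
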